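import Summits.NavierStokesRegularity.FluidComputer.DampedTransitionWindow

/-!
# Tao's delay gate under NON-UNIFORM diagonal damping, part 5: the trigger FIRES (after `t_c`)

Companion of `DampedTransition{,Quiet,Window}.lean` (cell `pub-fluidc`, seat bp1). HONEST FRAMING (verbatim):
low prior, high value-of-information experiment on Tao's machine paradigm; NOT a claim that NS blows up.
Everything concerns the five-mode truncation (5.5) of [Tao2016AveragedNS, §5.5] with a diagonal damping
`-E(t) * X(t)`, `0 ≤ Eᵢ(t) ≤ η ≤ 1/100`, on the window `[0,2]`; nothing is proved about Navier–Stokes.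
§PhaseTwo of the printed bootstrap (`Thm53With.b_lower_after … V_remainder_le`), damped; first file of the
FIRING phase (bp1 item S1b, plan `pub-fluidc-bp1/PLAN-S1b-firing-damped.md`). With `τ = t_c` the hitting time
of `K⁻¹⁰ε²` by `c` (`quietPhase`), on `[t_c,2]`: `output_mul_exp_monotoneOn` (`e^{ηt}ã` is non-decreasing —
the damped substitute for `delayCircuitWith_output_monotone`); `b_lower_after` (`b ≥ ε/8`; the extra drift
`-E₁b ≥ -ε/20`); `c_growth` (`c ≥ K⁻¹⁰ε²e^{(M/8-η)(t-t_c)}`); `c_large` ((c-large) `c ≥ K¹⁰⁰ε²` on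
`I = [t_c + δ, 2]` whenever `K¹¹¹ ≤ e^{Mδ/8}` — one power of `K` more than undamped pays for `e^{-η}`);
`c_deriv_bounds` ((cgrow-2) for the UNDAMPED part `μa² + νbc` of `∂ₜc`); `hasDerivAt_V`, `V_remainder_le`
(`V = adε²/c`, `∂ₜV = (a² - d²) + R`, `|R| ≤ 9K⁻⁹⁰` on `I`; the damping adds `-(E₀ + E₃ - E₂)V`).
Not here: (atc), (douse), (beable) — files 6–7 of the plan. [cite: Tao2016AveragedNS, §5.5 Thm 5.3 proof: (c-large),
(cgrow-2), (douse)]. No named facts; 0 sorry.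
-/

noncomputable section

namespace Summit.NavierStokesRegularity.FluidComputer

open Real Set Filter Topology
open Literature.Analysis.FluidPDE.Tao2016AveragedNS
open Literature.Analysis.FluidPDE.Tao2016AveragedNS.Thm53 (monotoneOn_intFactor monotoneOn_sub_of_le_deriv)

namespace DampedTransition

section PhaseTwo

variable {K M ε η τ δ : ℝ} {E X : ℝ → Fin 5 → ℝ}

/-- **Output surrogate monotonicity under damping**: `t ↦ e^{ηt}·ã(t)` is non-decreasing on `[0,2]`
(`∂ₜ(e^{ηt}ã) = e^{ηt}(Kd² + (η - E₄)ã) ≥ 0`, using `ã ≥ 0`). Replaces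
`delayCircuitWith_output_monotone` of the undamped bootstrap. [cite: Tao2016AveragedNS, §5.5 proof] -/
theorem output_mul_exp_monotoneOn
    (hX : ∀ t ∈ Icc (0:ℝ) 2, HasDerivAt X (delayCircuitWith K M ε (X t) - E t * X t) t)
    (hE : ∀ t ∈ Icc (0:ℝ) 2, ∀ i, 0 ≤ E t i ∧ E t i ≤ η) (h0 : X 0 = delayInit) (hK : 0 ≤ K) :
    MonotoneOn (fun t => X t 4 * exp (η * t)) (Icc 0 2) := by
  have hderiv : ∀ t ∈ Icc (0:ℝ) 2, HasDerivAt (fun s => X s 4 * exp (η * s))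
      ((K * X t 3 ^ 2 - E t 4 * X t 4) * exp (η * t) + X t 4 * (exp (η * t) * η)) t := by
    intro t ht
    have h1 : HasDerivAt (fun s : ℝ => η * s) η t := by
      simpa using (hasDerivAt_id t).const_mul η
    exact (hasDerivAt_e (hX t ht)).mul h1.exp
  refine monotoneOn_of_hasDerivWithinAt_nonneg (convex_Icc 0 2)
    (fun t ht => (hderiv t ht).continuousAt.continuousWithinAt)
    (fun t ht => (hderiv t (interior_subset ht)).hasDerivWithinAt) ?_
  intro t ht
  have ht' : t ∈ Icc (0:ℝ) 2 := interior_subset ht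
  have he0 : 0 ≤ X t 4 := e_nonneg hX hE h0 hK ht'
  have hE4 := hE t ht' 4
  have hpos : 0 < exp (η * t) := exp_pos _
  have h1 : 0 ≤ K * X t 3 ^ 2 := mul_nonneg hK (sq_nonneg _)
  have h2 : 0 ≤ (η - E t 4) * X t 4 := mul_nonneg (by linarith [hE4.2]) he0
  nlinarith [mul_nonneg (add_nonneg h1 h2) hpos.le]

/-- `b ≥ ε/8` on `[τ,2]` under damping `η ≤ 1/100`: from (bogo-2) `b(τ) ≥ (1-θ)ετ ≥ ε/2` and
`∂ₜb ≥ -ε⁻¹Mc² - E₁b ≥ -ε/16 - ε/20`. [cite: Tao2016AveragedNS, §5.5 proof ("b ≳ ε on [t_c,2]")] -/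
theorem b_lower_after
    (hX : ∀ t ∈ Icc (0:ℝ) 2, HasDerivAt X (delayCircuitWith K M ε (X t) - E t * X t) t)
    (hE : ∀ t ∈ Icc (0:ℝ) 2, ∀ i, 0 ≤ E t i ∧ E t i ≤ η) (h0 : X 0 = delayInit)
    (hε : 0 < ε) (hε1 : ε ≤ 1) (hM0 : 0 < M) (hMK : M ≤ K ^ 10) (hK : 16 ≤ K) (hεK : ε ^ 2 ≤ 1 / (6 * K ^ 20))
    (hεexp : ε ^ 2 ≤ exp (-(18 * M)) / (64 * M)) (hη : η ≤ 1 / 100)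
    (hτ1 : 1 ≤ τ) (hτ2 : τ ≤ 2)
    (hcτ : ∀ t, 0 ≤ t → t ≤ τ → X t 2 ≤ ε ^ 2 / K ^ 10)
    {t : ℝ} (ht : t ∈ Icc τ 2) : ε / 8 ≤ X t 1 := by
  have hK0 : 0 < K := by linarith
  have hK1 : 1 ≤ K := by linarith
  have hη0 : 0 ≤ η := (hE 0 ⟨le_rfl, zero_le_two⟩ 0).1.trans (hE 0 ⟨le_rfl, zero_le_two⟩ 0).2
  have hbτ : ε / 2 ≤ X τ 1 := by
    have hb := b_window hX hE h0 hε hε1 hM0 hMK hK1 hτ2 hεK hcτ (t := τ) ⟨by linarith, le_rfl⟩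
    have h1 := (abs_le.1 hb).1
    have hK20 : (2:ℝ) ^ 20 ≤ K ^ 20 := pow_le_pow_left₀ (by norm_num) (by linarith) 20
    have hθ : 17 / K ^ 20 + 9 * η ≤ 1 / 2 := by
      have : 17 / K ^ 20 ≤ 1 / 4 := by
        rw [div_le_div_iff₀ (by positivity) (by norm_num)]; norm_num at hK20 ⊢; linarith
      linarith
    have h2 : (17 / K ^ 20 + 9 * η) * ε * τ ≤ 1 / 2 * ε * τ :=
      mul_le_mul_of_nonneg_right (mul_le_mul_of_nonneg_right hθ hε.le) (by linarith)
    have h3 : ε ≤ ε * τ := le_mul_of_one_le_right hε.le hτ1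
    nlinarith
  -- `∂ₜb ≥ -ε/16 - ε/20` on `[τ,2]`
  have hmono := monotoneOn_sub_of_le_deriv (φ := fun _ => -(ε / 16) - ε / 20)
    (Φ := fun s => (-(ε / 16) - ε / 20) * s) (convex_Icc τ 2)
    (fun s hs => hasDerivAt_b (hX s ⟨by linarith [hs.1], hs.2⟩))
    (fun s _ => ((hasDerivAt_id s).const_mul (-(ε / 16) - ε / 20)).congr_deriv (by simp))
    (fun s hs => by
      have hs02 : s ∈ Icc (0 : ℝ) 2 := ⟨by linarith [hs.1], hs.2⟩
      have hc0 : 0 ≤ X s 2 := c_nonneg hX hE h0 hε hε1 hM0.le hs02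
      have hcc : X s 2 ≤ 2 * ε ^ 2 * exp ((5 * s - 1) * M) := c_crude hX hE h0 hε hε1 hM0.le hs02
      have hc9 : X s 2 ≤ 2 * ε ^ 2 * exp (9 * M) := by
        refine hcc.trans (mul_le_mul_of_nonneg_left (exp_le_exp.2 ?_) (by positivity))
        nlinarith [hs.2]
      have hc2 : X s 2 ^ 2 ≤ (2 * ε ^ 2 * exp (9 * M)) ^ 2 := pow_le_pow_left₀ hc0 hc9 2
      -- `ν c² ≤ 4 M ε³ e^{18M} ≤ ε/16`
      have hνc : ε⁻¹ * M * X s 2 ^ 2 ≤ ε / 16 := by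
        have hε2 : ε ^ 2 * exp (18 * M) ≤ 1 / (64 * M) := by
          calc ε ^ 2 * exp (18 * M) ≤ exp (-(18 * M)) / (64 * M) * exp (18 * M) :=
                mul_le_mul_of_nonneg_right hεexp (exp_pos _).le
            _ = 1 / (64 * M) := by
                rw [div_mul_eq_mul_div, mul_comm (exp _) (exp _), ← exp_add, add_neg_cancel,
                  exp_zero]
        calc ε⁻¹ * M * X s 2 ^ 2 ≤ ε⁻¹ * M * (2 * ε ^ 2 * exp (9 * M)) ^ 2 :=
              mul_le_mul_of_nonneg_left hc2 (by positivity)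
          _ = 4 * M * ε * (ε ^ 2 * exp (18 * M)) := by
              rw [show (18 : ℝ) * M = 9 * M + 9 * M by ring, exp_add]
              field_simp
              ring
          _ ≤ 4 * M * ε * (1 / (64 * M)) := mul_le_mul_of_nonneg_left hε2 (by positivity)
          _ = ε / 16 := by field_simp; ring
      -- `E₁ b ≤ 5ηε ≤ ε/20`
      have hEb : E s 1 * X s 1 ≤ ε / 20 := by
        have hb5 : |X s 1| ≤ 5 * ε := (bc_small hX hE h0 hε hε1 hM0.le hs02).1
        have hE1 := hE s hs02 1
        calc E s 1 * X s 1 ≤ E s 1 * |X s 1| :=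
              mul_le_mul_of_nonneg_left (le_abs_self _) hE1.1
          _ ≤ η * (5 * ε) := mul_le_mul hE1.2 hb5 (abs_nonneg _) hη0
          _ ≤ 1 / 100 * (5 * ε) := mul_le_mul_of_nonneg_right hη (by positivity)
          _ = ε / 20 := by ring
      have ha2 : 0 ≤ ε * X s 0 ^ 2 := by positivity
      show -(ε / 16) - ε / 20 ≤ ε * X s 0 ^ 2 - ε⁻¹ * M * X s 2 ^ 2 - E s 1 * X s 1
      linarith)
  have hτmem : τ ∈ Icc τ 2 := ⟨le_rfl, hτ2⟩
  have h := hmono hτmem ht ht.1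
  simp only at h
  have h1 : t - τ ≤ 1 := by linarith [ht.2]
  have h2 : (ε / 16 + ε / 20) * (t - τ) ≤ (ε / 16 + ε / 20) * 1 :=
    mul_le_mul_of_nonneg_left h1 (by positivity)
  nlinarith

/-- Exponential growth after `t_c` under damping: `c(t) ≥ K⁻¹⁰ε²·exp((M/8 - η)(t - τ))` on `[τ,2]`
(`∂ₜc ≥ (ε⁻¹Mb - E₂)c ≥ (M/8 - η)c`). [cite: Tao2016AveragedNS, §5.5 (c-large)] -/
theorem c_growth
    (hX : ∀ t ∈ Icc (0:ℝ) 2, HasDerivAt X (delayCircuitWith K M ε (X t) - E t * X t) t)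
    (hE : ∀ t ∈ Icc (0:ℝ) 2, ∀ i, 0 ≤ E t i ∧ E t i ≤ η) (h0 : X 0 = delayInit)
    (hε : 0 < ε) (hε1 : ε ≤ 1) (hM0 : 0 < M) (hMK : M ≤ K ^ 10) (hK : 16 ≤ K) (hεK : ε ^ 2 ≤ 1 / (6 * K ^ 20))
    (hεexp : ε ^ 2 ≤ exp (-(18 * M)) / (64 * M)) (hη : η ≤ 1 / 100)
    (hτ1 : 1 ≤ τ) (hτ2 : τ ≤ 2)
    (hcτ : ∀ t, 0 ≤ t → t ≤ τ → X t 2 ≤ ε ^ 2 / K ^ 10) (hcτeq : X τ 2 = ε ^ 2 / K ^ 10)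
    {t : ℝ} (ht : t ∈ Icc τ 2) :
    ε ^ 2 / K ^ 10 * exp ((M / 8 - η) * (t - τ)) ≤ X t 2 := by
  have hK0 : 0 < K := by linarith
  have hmono := monotoneOn_intFactor (s := Icc τ 2) (g := fun _ => M / 8 - η)
    (G := fun s => (M / 8 - η) * s) (φ := fun _ => 0) (Φ := fun _ => 0) (convex_Icc τ 2)
    (fun s hs => hasDerivAt_c (hX s ⟨by linarith [hs.1], hs.2⟩))
    (fun s _ => ((hasDerivAt_id s).const_mul (M / 8 - η)).congr_deriv (by simp))
    (fun s _ => hasDerivAt_const s (0 : ℝ))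
    (fun s hs => by
      have hs02 : s ∈ Icc (0 : ℝ) 2 := ⟨by linarith [hs.1], hs.2⟩
      have hc0 : 0 ≤ X s 2 := c_nonneg hX hE h0 hε hε1 hM0.le hs02
      have hb : ε / 8 ≤ X s 1 :=
        b_lower_after hX hE h0 hε hε1 hM0 hMK hK hεK hεexp hη hτ1 hτ2 hcτ hs
      have hνb : M / 8 ≤ ε⁻¹ * M * X s 1 := by
        calc M / 8 = ε⁻¹ * M * (ε / 8) := by field_simp
          _ ≤ ε⁻¹ * M * X s 1 := mul_le_mul_of_nonneg_left hb (by positivity)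
      have h1 : M / 8 * X s 2 ≤ ε⁻¹ * M * X s 1 * X s 2 := mul_le_mul_of_nonneg_right hνb hc0
      have hE2 : E s 2 * X s 2 ≤ η * X s 2 := mul_le_mul_of_nonneg_right (hE s hs02 2).2 hc0
      have h2 : 0 ≤ ε ^ 2 * exp (-M) * X s 0 ^ 2 := by positivity
      have : 0 ≤ ε ^ 2 * exp (-M) * X s 0 ^ 2 + ε⁻¹ * M * X s 1 * X s 2 - E s 2 * X s 2
          - (M / 8 - η) * X s 2 := by nlinarith
      exact mul_nonneg this (exp_pos _).le)
  have hτmem : τ ∈ Icc τ 2 := ⟨le_rfl, hτ2⟩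
  have h := hmono hτmem ht ht.1
  simp only [sub_zero, hcτeq] at h
  have hEq : X t 2 = X t 2 * exp (-((M / 8 - η) * t)) * exp ((M / 8 - η) * t) := by
    rw [mul_assoc, ← exp_add, neg_add_cancel, exp_zero, mul_one]
  rw [hEq]
  calc ε ^ 2 / K ^ 10 * exp ((M / 8 - η) * (t - τ))
      = ε ^ 2 / K ^ 10 * exp (-((M / 8 - η) * τ)) * exp ((M / 8 - η) * t) := by
        rw [mul_assoc, ← exp_add]; congr 2; ring
    _ ≤ X t 2 * exp (-((M / 8 - η) * t)) * exp ((M / 8 - η) * t) :=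
        mul_le_mul_of_nonneg_right h (exp_pos _).le

/-- **(c-large) under damping**: `c ≥ K¹⁰⁰ε²` on `I = [τ + δ, 2]` for any onset delay `δ ≥ 0` with
`e^{Mδ/8} ≥ K¹¹¹` (undamped: `K¹¹⁰`; the extra power absorbs `e^{-η}`): "the rotor gate is continuously and
strongly activated from time `t_c + δ` onwards". [cite: Tao2016AveragedNS, §5.5 (c-large)] -/
theorem c_large
    (hX : ∀ t ∈ Icc (0:ℝ) 2, HasDerivAt X (delayCircuitWith K M ε (X t) - E t * X t) t)
    (hE : ∀ t ∈ Icc (0:ℝ) 2, ∀ i, 0 ≤ E t i ∧ E t i ≤ η) (h0 : X 0 = delayInit)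
    (hε : 0 < ε) (hε1 : ε ≤ 1) (hM0 : 0 < M) (hMK : M ≤ K ^ 10) (hK : 16 ≤ K) (hεK : ε ^ 2 ≤ 1 / (6 * K ^ 20))
    (hεexp : ε ^ 2 ≤ exp (-(18 * M)) / (64 * M)) (hη : η ≤ 1 / 100)
    (hδ : 0 ≤ δ) (hon : K ^ 111 ≤ exp (M * δ / 8))
    (hτ1 : 1 ≤ τ) (hτ2 : τ ≤ 2)
    (hcτ : ∀ t, 0 ≤ t → t ≤ τ → X t 2 ≤ ε ^ 2 / K ^ 10) (hcτeq : X τ 2 = ε ^ 2 / K ^ 10)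
    {t : ℝ} (ht : t ∈ Icc (τ + δ) 2) : K ^ 100 * ε ^ 2 ≤ X t 2 := by
  have hK0 : 0 < K := by linarith
  have hη0 : 0 ≤ η := (hE 0 ⟨le_rfl, zero_le_two⟩ 0).1.trans (hE 0 ⟨le_rfl, zero_le_two⟩ 0).2
  have ht' : t ∈ Icc τ 2 := ⟨by linarith [ht.1], ht.2⟩
  have hg := c_growth hX hE h0 hε hε1 hM0 hMK hK hεK hεexp hη hτ1 hτ2 hcτ hcτeq ht'
  have h1 : M * δ / 8 - η ≤ (M / 8 - η) * (t - τ) := by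
    have hd1 : M * δ ≤ M * (t - τ) := mul_le_mul_of_nonneg_left (by linarith [ht.1]) hM0.le
    have hd2 : η * (t - τ) ≤ η * 1 := mul_le_mul_of_nonneg_left (by linarith [ht.2]) hη0
    have e : (M / 8 - η) * (t - τ) = M * (t - τ) / 8 - η * (t - τ) := by ring
    rw [e]; linarith
  have h2 : 99 / 100 ≤ exp (-η) := by
    have := add_one_le_exp (-η)
    linarith
  have h3 : K ^ 111 * (99 / 100) ≤ exp ((M / 8 - η) * (t - τ)) :=
    calc K ^ 111 * (99 / 100) ≤ exp (M * δ / 8) * exp (-η) :=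
          mul_le_mul hon h2 (by norm_num) (exp_pos _).le
      _ = exp (M * δ / 8 - η) := by rw [← exp_add]; ring_nf
      _ ≤ exp ((M / 8 - η) * (t - τ)) := exp_le_exp.2 h1
  have hA : K ^ 100 * ε ^ 2 ≤ ε ^ 2 / K ^ 10 * (K ^ 111 * (99 / 100)) := by
    rw [div_mul_eq_mul_div, le_div_iff₀ (by positivity)]
    have hk : K ^ 110 ≤ 99 / 100 * K * K ^ 110 := by nlinarith [pow_pos hK0 110]
    have e1 : K ^ 100 * ε ^ 2 * K ^ 10 = ε ^ 2 * K ^ 110 := by ring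
    have e2 : ε ^ 2 * (K ^ 111 * (99 / 100)) = ε ^ 2 * (99 / 100 * K * K ^ 110) := by ring
    rw [e1, e2]
    exact mul_le_mul_of_nonneg_left hk (pow_pos hε 2).le
  exact hA.trans ((mul_le_mul_of_nonneg_left h3 (by positivity)).trans hg)

/-- (cgrow-2) for the undamped part of `∂ₜc` on `I`: `0 ≤ μa² + νbc ≤ 6K¹⁰c` (so
`-ηc ≤ ∂ₜc ≤ 6K¹⁰c`). [cite: Tao2016AveragedNS, §5.5 (cgrow-2)] -/
theorem c_deriv_bounds
    (hX : ∀ t ∈ Icc (0:ℝ) 2, HasDerivAt X (delayCircuitWith K M ε (X t) - E t * X t) t)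
    (hE : ∀ t ∈ Icc (0:ℝ) 2, ∀ i, 0 ≤ E t i ∧ E t i ≤ η) (h0 : X 0 = delayInit)
    (hε : 0 < ε) (hε1 : ε ≤ 1) (hM0 : 0 < M) (hMK : M ≤ K ^ 10) (hK : 16 ≤ K) (hεK : ε ^ 2 ≤ 1 / (6 * K ^ 20))
    (hεexp : ε ^ 2 ≤ exp (-(18 * M)) / (64 * M)) (hη : η ≤ 1 / 100)
    (hδ : 0 ≤ δ) (hon : K ^ 111 ≤ exp (M * δ / 8))
    (hτ1 : 1 ≤ τ) (hτ2 : τ ≤ 2)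
    (hcτ : ∀ t, 0 ≤ t → t ≤ τ → X t 2 ≤ ε ^ 2 / K ^ 10) (hcτeq : X τ 2 = ε ^ 2 / K ^ 10)
    {t : ℝ} (ht : t ∈ Icc (τ + δ) 2) :
    0 ≤ ε ^ 2 * exp (-M) * X t 0 ^ 2 + ε⁻¹ * M * X t 1 * X t 2 ∧
      ε ^ 2 * exp (-M) * X t 0 ^ 2 + ε⁻¹ * M * X t 1 * X t 2 ≤ 6 * K ^ 10 * X t 2 := by
  have hK0 : 0 < K := by linarith
  have ht' : t ∈ Icc τ 2 := ⟨by linarith [ht.1], ht.2⟩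
  have ht02 : t ∈ Icc (0 : ℝ) 2 := ⟨by linarith [ht'.1], ht.2⟩
  have hc0 : 0 ≤ X t 2 := c_nonneg hX hE h0 hε hε1 hM0.le ht02
  have hcl : K ^ 100 * ε ^ 2 ≤ X t 2 :=
    c_large hX hE h0 hε hε1 hM0 hMK hK hεK hεexp hη hδ hon hτ1 hτ2 hcτ hcτeq ht
  have hb : ε / 8 ≤ X t 1 := b_lower_after hX hE h0 hε hε1 hM0 hMK hK hεK hεexp hη hτ1 hτ2 hcτ ht'
  have hb5 : |X t 1| ≤ 5 * ε := (bc_small hX hE h0 hε hε1 hM0.le ht02).1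
  have ha : X t 0 ^ 2 ≤ 1 := traj_sq_le_one hX hE h0 ht02 0
  constructor
  · have h1 : 0 ≤ ε⁻¹ * M * X t 1 * X t 2 := by
      have : 0 ≤ X t 1 := by linarith [hε.le]
      have := hM0.le
      positivity
    have := hM0.le
    positivity
  · have hek : exp (-M) ≤ 1 := by rw [exp_le_one_iff, neg_nonpos]; exact hM0.le
    have h1 : ε ^ 2 * exp (-M) * X t 0 ^ 2 ≤ K ^ 10 * X t 2 := by
      calc ε ^ 2 * exp (-M) * X t 0 ^ 2 ≤ ε ^ 2 * 1 * 1 :=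
            mul_le_mul (mul_le_mul_of_nonneg_left hek (by positivity)) ha (by positivity)
              (by positivity)
        _ ≤ K ^ 100 * ε ^ 2 := by
            have : (1 : ℝ) ≤ K ^ 100 := one_le_pow₀ (by linarith)
            nlinarith [pow_pos hε 2]
        _ ≤ X t 2 := hcl
        _ ≤ K ^ 10 * X t 2 := by
            have : (1 : ℝ) ≤ K ^ 10 := one_le_pow₀ (by linarith)
            nlinarith
    have h2 : ε⁻¹ * M * X t 1 * X t 2 ≤ 5 * K ^ 10 * X t 2 := by
      have hb' : X t 1 ≤ 5 * ε := (le_abs_self _).trans hb5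
      have h5 : ε⁻¹ * X t 1 ≤ 5 := by rw [inv_mul_le_iff₀ hε]; linarith
      have : ε⁻¹ * M * X t 1 * X t 2 = (ε⁻¹ * X t 1) * (M * X t 2) := by ring
      rw [this]
      have hkc : 0 ≤ M * X t 2 := mul_nonneg hM0.le hc0
      have hMc : M * X t 2 ≤ K ^ 10 * X t 2 := mul_le_mul_of_nonneg_right hMK hc0
      nlinarith
    linarith

/-! ## Equipartition: the corrector `V = a d ε²/c` under damping -/

/-- The corrector `V = a·d·ε²/c` has `∂ₜV = (a² - d²) + R` with
`R = -(εabd + μacd + Kadã)ε²/c - ad(ε²/c)((μa² + νbc)/c) - (E₀ + E₃ - E₂)·V` (product rule; the rotor terms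
give exactly `a² - d²`; the last term is the damping's). [cite: Tao2016AveragedNS, §5.5 (douse)] -/
theorem hasDerivAt_V {t : ℝ} (hXt : HasDerivAt X (delayCircuitWith K M ε (X t) - E t * X t) t)
    (hε : ε ≠ 0) (hc : X t 2 ≠ 0) :
    HasDerivAt (fun s => X s 0 * X s 3 * (ε ^ 2 * (X s 2)⁻¹))
      ((X t 0 ^ 2 - X t 3 ^ 2) +
        ((-(ε * X t 0 * X t 1 * X t 3 + ε ^ 2 * exp (-M) * X t 0 * X t 2 * X t 3
            + K * X t 0 * X t 3 * X t 4) * (ε ^ 2 * (X t 2)⁻¹)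
          - X t 0 * X t 3 * (ε ^ 2 * (X t 2)⁻¹) *
            ((ε ^ 2 * exp (-M) * X t 0 ^ 2 + ε⁻¹ * M * X t 1 * X t 2) * (X t 2)⁻¹))
          - (E t 0 + E t 3 - E t 2) * (X t 0 * X t 3 * (ε ^ 2 * (X t 2)⁻¹)))) t := by
  have h1 := (hasDerivAt_a hXt).fun_mul (hasDerivAt_d hXt)
  have h2 := ((hasDerivAt_c hXt).fun_inv hc).const_mul (ε ^ 2)
  refine (h1.fun_mul h2).congr_deriv ?_
  field_simp
  ring

/-- Size of the remainder in `∂ₜV` on `I`: `|R| ≤ 9K⁻⁹⁰` (uses `ε²/c ≤ K⁻¹⁰⁰`, (cgrow-2), all modes `O(1)`,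
and `|E₀ + E₃ - E₂| ≤ 3η ≤ 1` for the damping's term). [cite: Tao2016AveragedNS, §5.5 (douse)] -/
theorem V_remainder_le
    (hX : ∀ t ∈ Icc (0:ℝ) 2, HasDerivAt X (delayCircuitWith K M ε (X t) - E t * X t) t)
    (hE : ∀ t ∈ Icc (0:ℝ) 2, ∀ i, 0 ≤ E t i ∧ E t i ≤ η) (h0 : X 0 = delayInit)
    (hε : 0 < ε) (hε1 : ε ≤ 1) (hM0 : 0 < M) (hMK : M ≤ K ^ 10) (hK : 16 ≤ K) (hεK : ε ^ 2 ≤ 1 / (6 * K ^ 20))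
    (hεexp : ε ^ 2 ≤ exp (-(18 * M)) / (64 * M)) (hη : η ≤ 1 / 100)
    (hδ : 0 ≤ δ) (hon : K ^ 111 ≤ exp (M * δ / 8))
    (hτ1 : 1 ≤ τ) (hτ2 : τ ≤ 2)
    (hcτ : ∀ t, 0 ≤ t → t ≤ τ → X t 2 ≤ ε ^ 2 / K ^ 10) (hcτeq : X τ 2 = ε ^ 2 / K ^ 10)
    {t : ℝ} (ht : t ∈ Icc (τ + δ) 2) :
    |(-(ε * X t 0 * X t 1 * X t 3 + ε ^ 2 * exp (-M) * X t 0 * X t 2 * X t 3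
            + K * X t 0 * X t 3 * X t 4) * (ε ^ 2 * (X t 2)⁻¹)
          - X t 0 * X t 3 * (ε ^ 2 * (X t 2)⁻¹) *
            ((ε ^ 2 * exp (-M) * X t 0 ^ 2 + ε⁻¹ * M * X t 1 * X t 2) * (X t 2)⁻¹))
          - (E t 0 + E t 3 - E t 2) * (X t 0 * X t 3 * (ε ^ 2 * (X t 2)⁻¹))|
      ≤ 9 / K ^ 90 := by
  have hK0 : 0 < K := by linarith
  have hK1 : 1 ≤ K := by linarith
  have ht02 : t ∈ Icc (0 : ℝ) 2 := ⟨by linarith [ht.1], ht.2⟩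
  have hcl : K ^ 100 * ε ^ 2 ≤ X t 2 :=
    c_large hX hE h0 hε hε1 hM0 hMK hK hεK hεexp hη hδ hon hτ1 hτ2 hcτ hcτeq ht
  have hcpos : 0 < X t 2 := lt_of_lt_of_le (by positivity) hcl
  obtain ⟨hc'0, hc'6⟩ :=
    c_deriv_bounds hX hE h0 hε hε1 hM0 hMK hK hεK hεexp hη hδ hon hτ1 hτ2 hcτ hcτeq ht
  set q : ℝ := ε ^ 2 * (X t 2)⁻¹ with hq
  have hq0 : 0 ≤ q := by positivity
  have hq1 : q ≤ 1 / K ^ 100 := by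
    simp only [hq]
    rw [← div_eq_mul_inv, div_le_div_iff₀ hcpos (by positivity), one_mul]
    linarith
  set c' : ℝ := ε ^ 2 * exp (-M) * X t 0 ^ 2 + ε⁻¹ * M * X t 1 * X t 2 with hc'
  have hrat0 : 0 ≤ c' * (X t 2)⁻¹ := by positivity
  have hrat : c' * (X t 2)⁻¹ ≤ 6 * K ^ 10 := by
    rw [← div_eq_mul_inv, div_le_iff₀ hcpos]; exact hc'6
  have ha : |X t 0| ≤ 1 := traj_abs_le_one hX hE h0 ht02 0
  have hb : |X t 1| ≤ 1 := traj_abs_le_one hX hE h0 ht02 1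
  have hc : |X t 2| ≤ 1 := traj_abs_le_one hX hE h0 ht02 2
  have hd : |X t 3| ≤ 1 := traj_abs_le_one hX hE h0 ht02 3
  have he : |X t 4| ≤ 1 := traj_abs_le_one hX hE h0 ht02 4
  -- term 1
  have hT1 : |(-(ε * X t 0 * X t 1 * X t 3 + ε ^ 2 * exp (-M) * X t 0 * X t 2 * X t 3
      + K * X t 0 * X t 3 * X t 4) * q)| ≤ (2 + K) * (1 / K ^ 100) := by
    rw [abs_mul, abs_neg, abs_of_nonneg hq0]
    have hin : |ε * X t 0 * X t 1 * X t 3 + ε ^ 2 * exp (-M) * X t 0 * X t 2 * X t 3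
        + K * X t 0 * X t 3 * X t 4| ≤ 2 + K := by
      have e1 : |ε * X t 0 * X t 1 * X t 3| ≤ 1 := by
        rw [abs_mul, abs_mul, abs_mul, abs_of_pos hε]
        calc ε * |X t 0| * |X t 1| * |X t 3| ≤ 1 * 1 * 1 * 1 := by gcongr
          _ = 1 := by ring
      have e2 : |ε ^ 2 * exp (-M) * X t 0 * X t 2 * X t 3| ≤ 1 := by
        have hμ1 : ε ^ 2 * exp (-M) ≤ 1 := by
          have hek : exp (-M) ≤ 1 := by rw [exp_le_one_iff, neg_nonpos]; exact hM0.le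
          calc ε ^ 2 * exp (-M) ≤ 1 ^ 2 * 1 :=
                mul_le_mul (pow_le_pow_left₀ hε.le hε1 2) hek (exp_pos _).le (by positivity)
            _ = 1 := by ring
        rw [abs_mul, abs_mul, abs_mul, abs_of_nonneg (by positivity : 0 ≤ ε ^ 2 * exp (-M))]
        calc ε ^ 2 * exp (-M) * |X t 0| * |X t 2| * |X t 3| ≤ 1 * 1 * 1 * 1 := by gcongr
          _ = 1 := by ring
      have e3 : |K * X t 0 * X t 3 * X t 4| ≤ K := by
        rw [abs_mul, abs_mul, abs_mul, abs_of_pos hK0]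
        calc K * |X t 0| * |X t 3| * |X t 4| ≤ K * 1 * 1 * 1 := by gcongr
          _ = K := by ring
      calc _ ≤ |ε * X t 0 * X t 1 * X t 3 + ε ^ 2 * exp (-M) * X t 0 * X t 2 * X t 3|
            + |K * X t 0 * X t 3 * X t 4| := abs_add_le _ _
        _ ≤ |ε * X t 0 * X t 1 * X t 3| + |ε ^ 2 * exp (-M) * X t 0 * X t 2 * X t 3|
            + |K * X t 0 * X t 3 * X t 4| := by
            have := abs_add_le (ε * X t 0 * X t 1 * X t 3)
              (ε ^ 2 * exp (-M) * X t 0 * X t 2 * X t 3)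
            linarith
        _ ≤ 2 + K := by linarith
    exact mul_le_mul hin hq1 hq0 (by positivity)
  -- term 2
  have hT2 : |X t 0 * X t 3 * q * (c' * (X t 2)⁻¹)| ≤ 6 * K ^ 10 * (1 / K ^ 100) := by
    rw [abs_mul, abs_mul, abs_mul, abs_of_nonneg hq0, abs_of_nonneg hrat0]
    calc |X t 0| * |X t 3| * q * (c' * (X t 2)⁻¹) ≤ 1 * 1 * (1 / K ^ 100) * (6 * K ^ 10) := by
          gcongr
      _ = 6 * K ^ 10 * (1 / K ^ 100) := by ring
  -- term 3 (the damping's)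
  have hT3 : |(E t 0 + E t 3 - E t 2) * (X t 0 * X t 3 * q)| ≤ 1 * (1 / K ^ 100) := by
    have hE0 := hE t ht02 0
    have hE2 := hE t ht02 2
    have hE3 := hE t ht02 3
    have hEs : |E t 0 + E t 3 - E t 2| ≤ 1 := by
      rw [abs_le]; constructor <;> linarith [hE0.1, hE0.2, hE2.1, hE2.2, hE3.1, hE3.2]
    rw [abs_mul, abs_mul, abs_mul, abs_of_nonneg hq0]
    calc |E t 0 + E t 3 - E t 2| * (|X t 0| * |X t 3| * q) ≤ 1 * (1 * 1 * (1 / K ^ 100)) := by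
          gcongr
      _ = 1 * (1 / K ^ 100) := by ring
  have hsum : (2 + K) * (1 / K ^ 100) + 6 * K ^ 10 * (1 / K ^ 100) + 1 * (1 / K ^ 100)
      ≤ 9 / K ^ 90 := by
    have h10 : 3 + K ≤ 3 * K ^ 10 := by
      have : K ≤ K ^ 10 := le_self_pow₀ hK1 (by norm_num)
      linarith
    rw [show 9 / K ^ 90 = 9 * K ^ 10 * (1 / K ^ 100) by field_simp]
    have : 0 ≤ 1 / K ^ 100 := by positivity
    nlinarith
  calc _ ≤ |(-(ε * X t 0 * X t 1 * X t 3 + ε ^ 2 * exp (-M) * X t 0 * X t 2 * X t 3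
        + K * X t 0 * X t 3 * X t 4) * q) - X t 0 * X t 3 * q * (c' * (X t 2)⁻¹)|
        + |(E t 0 + E t 3 - E t 2) * (X t 0 * X t 3 * q)| := abs_sub _ _
    _ ≤ (|(-(ε * X t 0 * X t 1 * X t 3 + ε ^ 2 * exp (-M) * X t 0 * X t 2 * X t 3
        + K * X t 0 * X t 3 * X t 4) * q)| + |X t 0 * X t 3 * q * (c' * (X t 2)⁻¹)|)
        + |(E t 0 + E t 3 - E t 2) * (X t 0 * X t 3 * q)| :=
        add_le_add (abs_sub _ _) le_rfl
    _ ≤ (2 + K) * (1 / K ^ 100) + 6 * K ^ 10 * (1 / K ^ 100) + 1 * (1 / K ^ 100) :=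
        add_le_add (add_le_add hT1 hT2) hT3
    _ ≤ 9 / K ^ 90 := hsum

end PhaseTwo

end DampedTransition
end Summit.NavierStokesRegularity.FluidComputer
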